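import Summits.QuantumFields.QCD.Theorems.QuarksAsStableActionWilsonQuarkStabilityTangentLinearKernel

/-!
# The linear term of the tangent functional is bounded by the link deficits
(helper of the lead's stub `stub_freeTangentBound_of`, line `Sketch`, idea `free-tangent-landau-chessboard`,
crux `QuarksAsStableAction.WilsonQuarkStability`, item stmt-QuantumFields-9736)

`linear_term_le`: with the free twisted propagator `Dinv` given entrywise by the Fourier kernel of
`stub_freeTwistedFourier` (constant phase `e^{iπ/L}`, i.e. ANTIPERIODIC momenta `φ = (2k+1)π/L`) and the
perturbation `Δ = D[ω V] − D[ω]` given by its hopping blocks,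
`2 Re Tr(Dinv Δ) ≤ 76 · (L⁻⁴ Σ_k 1/h(k)) · Σ_e (3 − Re tr V_e)` for `|m| ≤ 1/2`.
The link coefficients are real (`conj_sum_apCoefficient`: reflection `k ↦ -k-1` of the antiperiodic grid), so
the `Im tr V_e` direction — which no multiple of the deficit controls on `U(3)` — drops out exactly; this is the
"free current vanishes" step of the idea card.  Pure theorem file (no definitions).
-/
namespace Summit.QuantumFields.QCD.Cruxes.WilsonQuarkStability.FreeTangentLandauChessboard

open Literature.MathematicalPhysics Literature.MathematicalPhysics.QuantumLattice
  Literature.MathematicalPhysics.QuantumFieldTheory Literature.Probability.LatticeModels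
open Matrix Complex
open scoped Kronecker ComplexOrder ComplexConjugate BigOperators

noncomputable section

variable {L : ℕ} [NeZero L]
/-! ### The linear term -/

/-- For `g ∈ U(3)`, `Re tr g ≤ 3` (each entry of a unitary matrix has norm ≤ 1). -/
theorem plaquetteDeficit_nonneg_aux (g : Matrix.unitaryGroup (Fin 3) ℂ) :
    ((g : Matrix (Fin 3) (Fin 3) ℂ)).trace.re ≤ 3 := by
  rw [Matrix.trace, Complex.re_sum]
  calc ∑ a, ((g : Matrix (Fin 3) (Fin 3) ℂ).diag a).re ≤ ∑ _a : Fin 3, (1 : ℝ) :=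
        Finset.sum_le_sum fun a _ => (Complex.re_le_norm _).trans (entry_norm_bound_of_unitary g.2 a a)
    _ = 3 := by simp

/-- Real parts: `Re(c S + d conj S) = Re((c + conj d) S)`. -/
theorem re_mul_add_mul_conj (c d S : ℂ) : (c * S + d * conj S).re = ((c + conj d) * S).re := by
  simp only [Complex.add_re, Complex.add_im, Complex.mul_re, Complex.conj_re, Complex.conj_im]
  ring

/-- **The linear term of the tangent functional is bounded by the link deficits.**  With the free twisted
propagator `Dinv` given entrywise by the Fourier kernel (stub `stub_freeTwistedFourier`) and the perturbation
`Δ` given entrywise by the hopping blocks of `D[ω V] − D[ω]`, `ω = e^{iπ/L}`: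
`2 Re Tr(Dinv Δ) ≤ 76 · (L⁻⁴ Σ_k 1/h(k)) · Σ_e (3 − Re tr V_e)` for `|m| ≤ 1/2`.  The link coefficients are
REAL by the reflection symmetry `k ↦ -k-1` of the antiperiodic grid (`conj_sum_apCoefficient`), so the
`Im tr V_e` direction drops out. -/
theorem linear_term_le (m : ℝ) (hm : |m| ≤ 1 / 2)
    (φ : TorusSite 4 L → Fin 4 → ℝ) (hφ : ∀ k ν, φ k ν = 2 * Real.pi * ((k ν).val : ℝ) / L + Real.pi / L)
    (w h : TorusSite 4 L → ℝ) (hw : ∀ k, w k = m + ∑ ν, (1 - Real.cos (φ k ν)))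
    (hh : ∀ k, h k = w k ^ 2 + ∑ ν, Real.sin (φ k ν) ^ 2) (hpos : ∀ k, 0 < h k)
    (M : TorusSite 4 L → Matrix (Fin 4) (Fin 4) ℂ)
    (hM : ∀ k, M k = ((w k : ℝ) : ℂ) • (1 : Matrix (Fin 4) (Fin 4) ℂ) +
      I • ∑ ν, ((Real.sin (φ k ν) : ℝ) : ℂ) • euclideanGamma ν)
    (Dinv Δ : Matrix (TorusSite 4 L × Fin 3 × Fin 4) (TorusSite 4 L × Fin 3 × Fin 4) ℂ)
    (hDinv : ∀ p q, Dinv p q = if p.2.1 = q.2.1 then ((L : ℂ) ^ 4)⁻¹ * ∑ k, torusChar k p.1 *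
      conj (torusChar k q.1) * (M k)ᴴ p.2.2 q.2.2 / ((h k : ℝ) : ℂ) else 0)
    (V : GaugeConfig 4 L (Matrix.unitaryGroup (Fin 3) ℂ))
    (hΔ : ∀ p q, Δ p q = -(1 / 2 : ℂ) * ∑ μ : Fin 4,
      ((if q.1 = QuantumFieldTheory.Site.shift p.1 μ then
          ((1 : Matrix (Fin 4) (Fin 4) ℂ) - euclideanGamma μ) p.2.2 q.2.2 *
            (Complex.exp (↑(Real.pi / L) * I) • ((V (p.1, μ) : Matrix (Fin 3) (Fin 3) ℂ) - 1)) p.2.1 q.2.1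
        else 0) +
        (if p.1 = QuantumFieldTheory.Site.shift q.1 μ then
          ((1 : Matrix (Fin 4) (Fin 4) ℂ) + euclideanGamma μ) p.2.2 q.2.2 *
            (Complex.exp (-(↑(Real.pi / L) * I)) • (star (V (q.1, μ) : Matrix (Fin 3) (Fin 3) ℂ) - 1)) p.2.1 q.2.1
        else 0))) :
    2 * (Dinv * Δ).trace.re ≤
      76 * (((L : ℝ) ^ 4)⁻¹ * ∑ k, (h k)⁻¹) *
        ∑ e : Edge 4 L, (3 - ((V e : Matrix (Fin 3) (Fin 3) ℂ)).trace.re) := by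
  set θ : ℝ := Real.pi / L with hθ
  -- the kernel
  set K : TorusSite 4 L → TorusSite 4 L → Matrix (Fin 4) (Fin 4) ℂ := fun x y =>
    Matrix.of fun α β => ((L : ℂ) ^ 4)⁻¹ * ∑ k, torusChar k x * conj (torusChar k y) * (M k)ᴴ α β /
      ((h k : ℝ) : ℂ) with hK
  have hDinv' : ∀ p q, Dinv p q = if p.2.1 = q.2.1 then K p.1 q.1 p.2.2 q.2.2 else 0 := fun p q => by
    rw [hDinv]; rfl
  -- colour factors
  set Cf : Fin 4 → TorusSite 4 L → Matrix (Fin 3) (Fin 3) ℂ := fun μ x =>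
    Complex.exp (↑θ * I) • ((V (x, μ) : Matrix (Fin 3) (Fin 3) ℂ) - 1) with hCf
  set Cb : Fin 4 → TorusSite 4 L → Matrix (Fin 3) (Fin 3) ℂ := fun μ y =>
    Complex.exp (-(↑θ * I)) • (star (V (y, μ) : Matrix (Fin 3) (Fin 3) ℂ) - 1) with hCb
  have htr := trace_kernel_mul_delta K Dinv Δ hDinv' (fun μ => (1 : Matrix (Fin 4) (Fin 4) ℂ) - euclideanGamma μ)
    (fun μ => (1 : Matrix (Fin 4) (Fin 4) ℂ) + euclideanGamma μ) Cf Cb (fun p q => by rw [hΔ p q])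
  -- the two kernel traces
  set A : Fin 4 → ℂ := fun μ => ((L : ℂ) ^ 4)⁻¹ * ∑ k, torusChar k (Pi.single μ 1) *
    ((M k)ᴴ * ((1 : Matrix (Fin 4) (Fin 4) ℂ) - euclideanGamma μ)).trace / ((h k : ℝ) : ℂ) with hA
  set B : Fin 4 → ℂ := fun μ => ((L : ℂ) ^ 4)⁻¹ * ∑ k, conj (torusChar k (Pi.single μ 1)) *
    ((M k)ᴴ * ((1 : Matrix (Fin 4) (Fin 4) ℂ) + euclideanGamma μ)).trace / ((h k : ℝ) : ℂ) with hB
  have hKf : ∀ μ y, (K (QuantumFieldTheory.Site.shift y μ) y * ((1 : Matrix (Fin 4) (Fin 4) ℂ) - euclideanGamma μ)).trace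
      = A μ := fun μ y => trace_kernel_shift_left M h _ y μ
  have hKb : ∀ μ x, (K x (QuantumFieldTheory.Site.shift x μ) * ((1 : Matrix (Fin 4) (Fin 4) ℂ) + euclideanGamma μ)).trace
      = B μ := fun μ x => trace_kernel_shift_right M h _ x μ
  -- traces of the colour factors
  set S : Fin 4 → ℂ := fun μ => ∑ x : TorusSite 4 L, (((V (x, μ) : Matrix (Fin 3) (Fin 3) ℂ)).trace - 3) with hS
  have hCf_tr : ∀ μ x, (Cf μ x).trace = Complex.exp (↑θ * I) * (((V (x, μ) : Matrix (Fin 3) (Fin 3) ℂ)).trace - 3) :=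
    fun μ x => by
      simp only [hCf, trace_smul, trace_sub, trace_one, Fintype.card_fin, smul_eq_mul]
      norm_num
  have hCb_tr : ∀ μ x, (Cb μ x).trace =
      Complex.exp (-(↑θ * I)) * (conj (((V (x, μ) : Matrix (Fin 3) (Fin 3) ℂ)).trace) - 3) := fun μ x => by
    simp only [hCb, trace_smul, trace_sub, trace_one, Fintype.card_fin, smul_eq_mul,
      Matrix.star_eq_conjTranspose, trace_conjTranspose, Complex.star_def]
    norm_num
  have htr2 : (Dinv * Δ).trace = -(1 / 2 : ℂ) * ∑ μ,
      (Complex.exp (↑θ * I) * A μ * S μ + Complex.exp (-(↑θ * I)) * B μ * conj (S μ)) := by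
    rw [htr]
    congr 1
    refine Finset.sum_congr rfl fun μ _ => ?_
    simp only [hKf, hKb, hCf_tr, hCb_tr, hS, map_sum, map_sub, ← Finset.mul_sum]
    have h3 : conj (3 : ℂ) = 3 := map_ofNat _ 3
    simp only [h3]
    ring
  -- the combined coefficient
  set Z : Fin 4 → ℂ := fun μ => ∑ k, Complex.exp (φ k μ * I) * ((w k : ℂ) + I * Real.sin (φ k μ)) / (h k : ℂ)
    with hZ
  have hcd : ∀ μ, Complex.exp (↑θ * I) * A μ + conj (Complex.exp (-(↑θ * I)) * B μ) =
      8 * ((L : ℂ) ^ 4)⁻¹ * Z μ := by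
    intro μ
    have hconjexp : conj (Complex.exp (-(↑θ * I))) = Complex.exp (↑θ * I) := by
      rw [← Complex.exp_conj, map_neg, map_mul, Complex.conj_ofReal, Complex.conj_I]; ring_nf
    have hconjB : conj (B μ) = ((L : ℂ) ^ 4)⁻¹ * ∑ k, torusChar k (Pi.single μ 1) *
        (M k * ((1 : Matrix (Fin 4) (Fin 4) ℂ) + euclideanGamma μ)).trace / ((h k : ℝ) : ℂ) := by
      simp only [hB, map_mul, map_sum, map_div₀, Complex.conj_conj, Complex.conj_ofReal, map_inv₀, map_pow,
        Complex.conj_natCast]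
      congr 1
      refine Finset.sum_congr rfl fun k _ => ?_
      congr 2
      rw [← Complex.star_def, ← trace_conjTranspose, conjTranspose_mul, conjTranspose_conjTranspose,
        conjTranspose_add, conjTranspose_one, (euclideanGamma_isHermitian μ).eq, trace_mul_comm]
    have hφk : ∀ k : TorusSite 4 L, Complex.exp ((φ k μ : ℂ) * I) =
        Complex.exp (↑θ * I) * Complex.exp (((2 * Real.pi * ((k μ).val : ℝ) / L : ℝ) : ℂ) * I) := fun k => by
      rw [← Complex.exp_add, hφ, hθ]; push_cast; ring_nf
    have hhk : ∀ k : TorusSite 4 L, ((h k : ℝ) : ℂ) ≠ 0 := fun k =>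
      Complex.ofReal_ne_zero.mpr (hpos k).ne'
    rw [map_mul, hconjexp, hconjB, hA, ← mul_add, ← mul_add, ← Finset.sum_add_distrib]
    simp only [hZ, Finset.mul_sum]
    refine Finset.sum_congr rfl fun k _ => ?_
    rw [← add_div, ← mul_add, hM k, trace_symbol_identity (w k) (fun ν => Real.sin (φ k ν)) μ,
      torusChar_single_eq_exp', hφk k]
    field_simp [hhk k]
  -- reality and size of `Z`
  have hZim : ∀ μ, (Z μ).im = 0 := fun μ => by
    have := conj_sum_apCoefficient m φ hφ w h hw hh μ
    exact Complex.conj_eq_iff_im.mp this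
  have hZnorm : ∀ μ, ‖Z μ‖ ≤ (|m| + 9) * ∑ k, (h k)⁻¹ := fun μ =>
    norm_sum_apCoefficient_le m φ w h hw hpos μ
  -- the real part of the trace
  set F : Fin 4 → ℝ := fun μ => ∑ x : TorusSite 4 L, (3 - ((V (x, μ) : Matrix (Fin 3) (Fin 3) ℂ)).trace.re) with hF
  have hSre : ∀ μ, (S μ).re = -F μ := fun μ => by
    simp only [hS, hF, Complex.re_sum, Complex.sub_re, ← Finset.sum_neg_distrib, neg_sub]
    norm_num
  have hFnn : ∀ μ, 0 ≤ F μ := fun μ => Finset.sum_nonneg fun x _ => by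
    have := plaquetteDeficit_nonneg_aux (V (x, μ))
    linarith
  have hre : 2 * (Dinv * Δ).trace.re = ∑ μ, 8 * ((L : ℝ) ^ 4)⁻¹ * ((Z μ).re * F μ) := by
    rw [htr2]
    have h2 : ∀ X : ℂ, 2 * (-(1 / 2 : ℂ) * X).re = -X.re := fun X => by
      simp [Complex.mul_re]
    rw [h2, Complex.re_sum, ← Finset.sum_neg_distrib]
    refine Finset.sum_congr rfl fun μ _ => ?_
    rw [re_mul_add_mul_conj, hcd μ]
    have h8 : (8 : ℂ) * ((L : ℂ) ^ 4)⁻¹ = (((8 * ((L : ℝ) ^ 4)⁻¹ : ℝ)) : ℂ) := by push_cast; ring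
    rw [h8, mul_assoc, Complex.re_ofReal_mul, Complex.mul_re, hZim μ, zero_mul, sub_zero, hSre μ]
    ring
  -- the total deficit splits over directions
  have hFsum : ∑ e : Edge 4 L, (3 - ((V e : Matrix (Fin 3) (Fin 3) ℂ)).trace.re) = ∑ μ, F μ := by
    rw [Fintype.sum_prod_type, Finset.sum_comm]
  rw [hre, hFsum, Finset.mul_sum]
  refine Finset.sum_le_sum fun μ _ => ?_
  have hL4 : 0 ≤ ((L : ℝ) ^ 4)⁻¹ := by positivity
  have hsum : 0 ≤ ∑ k, (h k)⁻¹ := Finset.sum_nonneg fun k _ => (inv_nonneg.mpr (hpos k).le)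
  calc 8 * ((L : ℝ) ^ 4)⁻¹ * ((Z μ).re * F μ)
      ≤ 8 * ((L : ℝ) ^ 4)⁻¹ * (‖Z μ‖ * F μ) :=
        mul_le_mul_of_nonneg_left (mul_le_mul_of_nonneg_right (Complex.re_le_norm _) (hFnn μ))
          (by positivity)
    _ ≤ 8 * ((L : ℝ) ^ 4)⁻¹ * (((|m| + 9) * ∑ k, (h k)⁻¹) * F μ) :=
        mul_le_mul_of_nonneg_left (mul_le_mul_of_nonneg_right (hZnorm μ) (hFnn μ)) (by positivity)
    _ ≤ 76 * (((L : ℝ) ^ 4)⁻¹ * ∑ k, (h k)⁻¹) * F μ := by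
        have hm9 : 8 * (|m| + 9) ≤ 76 := by linarith
        have := mul_le_mul_of_nonneg_right hm9 (mul_nonneg (mul_nonneg hL4 hsum) (hFnn μ))
        nlinarith [this]

end
end Summit.QuantumFields.QCD.Cruxes.WilsonQuarkStability.FreeTangentLandauChessboard
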